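import Mathlib
import Summits.Ventures.PercRepro.TriangleCapOneTriangleD
import Summits.Ventures.PercRepro.TriangleCapOneBelowDiagonal

/-!
# PercRepro — THE DENSE-CORNER STABILITY FOR `k ≥ 10`, AND THE CELLS ONE BELOW THE DIAGONAL (p3, gen 34; part 34)

* **`dense_stability`** — every `K₄⁻`-free graph on `k ≥ 10` vertices with `m ≥ 2k − 3` edges that is not
  complete bipartite spanning has `Σ_v d(v)² + (k − 2) ≤ m·k` (triangle-free: TriangleCapMantelStability;
  exactly one triangle: TriangleCapOneTriangleD; two triangles: TriangleCapDenseStabilityReduction);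
* **`dense_stability_cherries`** — in cherries: `2·Σ_v C(d(v), 2) ≤ (m − 1)(k − 2)` off the complete bipartite
  spanning graphs;
* **`one_below_diagonal_exact`** — for `k ≥ 10`, `1 ≤ a < k` with `m = a(k−a) − 1 ≥ 2k − 3` not of the form
  `a′(k − a′)`: the `K₄⁻`-free cherry maximum at `(k, m)` IS `(m − 1)(k − 2)/2`, attained by `K_{a,k−a}` minus
  an edge — the cells one below the diagonal of the dense corner, as the conjecture of P3-TRIANGLE-CAP.md
  §10as(c2) predicts.

Axioms: standard.
-/

namespace PercRepro

namespace TriangleCap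

namespace C047

open Finset

variable {V : Type*} [Fintype V] [DecidableEq V]

/-- **THE DENSE-CORNER STABILITY (`k ≥ 10`).** -/
theorem dense_stability (D : SimpleGraph V) [DecidableRel D.Adj] (hK : K4mFree D)
    (hk : 10 ≤ Fintype.card V) (hm : 2 * Fintype.card V ≤ D.edgeFinset.card + 3)
    (hnot : ¬ ∃ A : Finset V, ∀ x y, D.Adj x y ↔ Xor (x ∈ A) (y ∈ A)) :
    ∑ v, deg D v * deg D v + (Fintype.card V - 2) ≤ D.edgeFinset.card * Fintype.card V := by
  by_cases hfree : D.CliqueFree 3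
  · exact mantel_stability D hfree hnot
  · obtain ⟨S, hS⟩ := not_forall.mp hfree
    have hS' := not_not.mp hS
    rw [SimpleGraph.is3Clique_iff] at hS'
    obtain ⟨u, v, w, huv, huw, hvw, -⟩ := hS'
    by_cases hT : ∀ a b c, D.Adj a b → D.Adj a c → D.Adj b c → a = u ∨ a = v ∨ a = w
    · exact one_triangle_stability D hK hk huv huw hvw hT hm
    · simp only [not_forall, not_or] at hT
      obtain ⟨a, b, c, hab, hac, hbc, hau, hav, haw⟩ := hT
      have h12 := twelve_le_card_triangles3 D huv huw hvw hab hac hbc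
        (fun h => by rcases h with h | h | h; exact hau h; exact hav h; exact haw h)
      exact stability_of_two_triangles D hK hk h12

/-- The cherry form: `2·Σ_v C(d(v), 2) + 2m + (k − 2) ≤ m·k`. -/
theorem dense_stability_cherries (D : SimpleGraph V) [DecidableRel D.Adj] (hK : K4mFree D)
    (hk : 10 ≤ Fintype.card V) (hm : 2 * Fintype.card V ≤ D.edgeFinset.card + 3)
    (hnot : ¬ ∃ A : Finset V, ∀ x y, D.Adj x y ↔ Xor (x ∈ A) (y ∈ A)) :
    2 * cherries D + 2 * D.edgeFinset.card + (Fintype.card V - 2) ≤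
      D.edgeFinset.card * Fintype.card V := by
  have h := dense_stability D hK hk hm hnot
  rw [← two_mul_cherries_add, sum_deg_eq] at h
  exact h

/-- **ONE BELOW THE DIAGONAL, `K₄⁻`-FREE, EXACT (`k ≥ 10`):** for `1 ≤ a < k` with `m = a(k−a) − 1 ≥ 2k − 3` not
of the form `a′(k − a′)`, the maximum of `2·Σ_v C(d(v), 2)` over `K₄⁻`-free graphs with `m` edges on `k` vertices
is `(m − 1)(k − 2)`, attained by `K_{a,k−a}` minus an edge. -/
theorem one_below_diagonal_exact (k a : ℕ) (hk : 10 ≤ k) (ha : 1 ≤ a) (hak : a < k)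
    (hdense : 2 * k ≤ a * (k - a) - 1 + 3)
    (hm : ∀ a', a' ≤ k → a * (k - a) - 1 ≠ a' * (k - a')) :
    (∀ (D : SimpleGraph (Fin k)) [DecidableRel D.Adj], K4mFree D →
        D.edgeFinset.card = a * (k - a) - 1 → 2 * cherries D ≤ (a * (k - a) - 2) * (k - 2)) ∧
      ∃ (D : SimpleGraph (Fin k)) (_ : DecidableRel D.Adj), K4mFree D ∧
        D.edgeFinset.card = a * (k - a) - 1 ∧ 2 * cherries D = (a * (k - a) - 2) * (k - 2) := by
  have hka : 2 ≤ a * (k - a) := by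
    have h0 := hm 0 (Nat.zero_le _)
    simp only [Nat.zero_mul] at h0
    omega
  obtain ⟨m, hmm⟩ : ∃ m, a * (k - a) = m + 2 := ⟨a * (k - a) - 2, by omega⟩
  have e1 : a * (k - a) - 1 = m + 1 := by omega
  have e2 : a * (k - a) - 2 = m := by omega
  rw [e1, e2]
  obtain ⟨t, ht⟩ : ∃ t, k = t + 2 := ⟨k - 2, by omega⟩
  have e3 : k - 2 = t := by omega
  rw [e3]
  refine ⟨fun D _ hK hD => ?_, bipMinus k a, inferInstance, k4mFree_bipMinus k a,
    by have := card_edges_bipMinus k a ha hak; omega, ?_⟩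
  · have hnot : ¬ ∃ A : Finset (Fin k), ∀ x y, D.Adj x y ↔ Xor (x ∈ A) (y ∈ A) := by
      rintro ⟨A, hA⟩
      have := card_edges_eq_of_complete_bipartite D A hA
      rw [Fintype.card_fin, hD] at this
      exact hm A.card (by have := card_le_univ A; rw [Fintype.card_fin] at this; exact this)
        (by rw [e1]; exact this)
    have h := dense_stability_cherries D hK (by rw [Fintype.card_fin]; exact hk)
      (by rw [Fintype.card_fin, hD]; omega) hnot
    rw [Fintype.card_fin, hD, e3] at h
    have hk' : (m + 1) * k = m * t + t + 2 * (m + 1) := by rw [ht]; ring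
    rw [hk'] at h
    omega
  · have h := two_mul_cherries_bipMinus k a ha hak
    rw [hmm, e3] at h
    have hk' : (m + 2) * t = m * t + 2 * t := by ring
    rw [hk'] at h
    omega

end C047

end TriangleCap

end PercRepro
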